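import Summits.ResolutionOfSingularities.ResolutionOfSingularities.Theorems.HomologicalConductorNoZenoSubdivisionExcCurves
import Summits.ResolutionOfSingularities.ResolutionOfSingularities.Theorems.HomologicalConductorNoZenoSepNodesFinite
import Literature.AlgebraicGeometry.Resolution.ExceptionalCurvePoints
import HarnessLib

/-!
# Crux `NoZenoR` (stmt-ResolutionOfSingularities-19943), slot `stub_L1wCoreF`, (B1) split core, UP-6 — the subdivision clause
# FOR THE ACTUAL BLOW-UP OF THE NODE SET (`IsSepX1Sandwiched`'s `ρ : X¹ → X`)

Route `ResolutionOfSingularities/HomologicalConductor`, crux chain W4.4.  OURS (cell res-hironaka; planner res-L0-w44-plan-1 DESK WORDs 15/16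
«o5 → SUBDIVISION NODE-BLOW-UP CONSUMER: discharge hfib/hiso/hc/hC + hN₀ of `Subdivision.subdivision_clause_of_isAcyclic` for ρ = the blow-up
of `sepNodes π`»); AI-written, weaker than expert review; nothing of the manuscript under review (Hironaka 2017) is used and no Theses
declaration is asserted.  Def-free, `--supports 19943 --as helper`.

Setting: `π : X → Spec S` proper (`S` Noetherian local) with finitely many integral exceptional curves; `ρ : X¹ → X` a blow-up of the
vanishing ideal of `closure (sepNodes π)` — the literal clause of `IsSepX1Sandwiched` (`…NoZenoSplitExcCount`) — proper; `ψ := ρ ≫ π`.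
The NEW curves are `F := {n ∈ excCurvePoints ψ | ρ n ∈ sepNodes π}`.

Discharged here, from the tree: `hc`/`hC` (nodes are closed points and finitely many: `isClosed_singleton_of_mem_sepNodes`,
`isClosed_sepNodes`, p558363/p565476), `hiso` (a blow-up is an isomorphism off its centre: tree `IsBlowup.isIso_morphismRestrict`, and the
centre `closure (sepNodes π)` IS `sepNodes π = ρ(F)`), `hfib` and `ρ(F) = sepNodes π` from the ONE residual geometric input kept as a
hypothesis BY SIGNATURE —

  `hnode : ∀ z ∈ sepNodes π, ∃ n ∈ excCurvePoints (ρ ≫ π), ρ ⁻¹' {z} = closure {n}`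

(«over each node the fibre of the blow-up is ONE integral exceptional curve» — the node-curve package (n1) of res-L0-w44-stub-1:
`η_z ∈ excCurvePoints (ρ ≫ π)` with `primeDivisorIdeal η_z = 𝓘_z · 𝒪_{X¹}`, by taking supports: `Scheme.IdealSheafData.support_comap`,
`coe_support_primeDivisorIdeal`), `hN₀` from the split-core hypothesis «every node lies under two distinct exceptional curves»
(`sepNodes ⊆ 𝒩₀`), and `hht` from `IsResolution.height_le_one_of_base_eq_closedPoint` when `ψ` is a resolution of a two-dimensional `S`.

* `preimage_singleton_eq_closure` (hfib), `image_nodeCurves_eq` (`ρ '' F = sepNodes π`), `isClosed_image_nodeCurves` (hC),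
  `isIso_morphismRestrict_compl_image` (hiso);
* **`subdivision_nodeBlowup`** — the subdivision clause for the node blow-up: every new curve `n ∈ F` has exactly two neighbours in
  `incidenceGraph (ρ ≫ π)`, both old; `excCurvePoints_eq_image_nodeBlowup` — `excCurvePoints π = ρ '' (excCurvePoints ψ ∖ F)`;
  `subdivision_nodeBlowup_of_isResolution` — the same with `hht` discharged from `IsResolution (ρ ≫ π)`, `ringKrullDim S = 2`.

References: J. Lipman, Publ. Math. IHÉS 36 (1969) §24 (p. 258) [`Lipman1969`] (context); Görtz–Wedhorn I, Prop. 13.91 (3) (blow-ups are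
isomorphisms off the centre) [`GortzWedhorn2020`].
-/

noncomputable section

-- single-problem summit: the doubled namespace component `ResolutionOfSingularities` is forced
set_option linter.dupNamespace false

namespace Summit.ResolutionOfSingularities.ResolutionOfSingularities.Theorems.NoZeno.ExcCount.NodeBlowup

open CategoryTheory AlgebraicGeometry TopologicalSpace Topology IsLocalRing
open Literature.AlgebraicGeometry.Resolution Scheme.IdealSheafData

variable {S : Type} [CommRing S] [IsLocalRing S] {X X1 : Scheme.{0}} (π : X ⟶ Spec (.of S)) (ρ : X1 ⟶ X)
  (hnode : ∀ z ∈ sepNodes π, ∃ n ∈ excCurvePoints (ρ ≫ π), ρ.base ⁻¹' {z} = closure {n})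

include hnode in
/-- **hfib for the node blow-up**: an exceptional curve `n` of `ψ = ρ ≫ π` lying over a node IS the node curve over it, so the whole fibre
`ρ⁻¹(ρ n)` is `closure {n}` (two distinct height-one points do not specialise to one another). [folklore] -/
theorem preimage_singleton_eq_closure {n : X1} (hn : n ∈ excCurvePoints (ρ ≫ π)) (hz : ρ.base n ∈ sepNodes π) :
    ρ.base ⁻¹' {ρ.base n} = closure {n} := by
  obtain ⟨n₀, hn₀, hfib⟩ := hnode _ hz
  have hmem : n ∈ closure ({n₀} : Set X1) := by
    rw [← hfib]; exact Set.mem_singleton _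
  have hsp : n₀ ⤳ n := specializes_iff_mem_closure.mpr hmem
  by_cases hne : n = n₀
  · subst hne; exact hfib
  · exact absurd hsp (not_specializes_of_height_eq hne (by rw [hn.2, hn₀.2]) (by rw [hn.2]; exact ENat.coe_lt_top 1))

include hnode in
/-- **`ρ(F) = sepNodes π`**: the new curves map ONTO the node set (over every node there is a node curve). [folklore] -/
theorem image_nodeCurves_eq :
    ρ.base '' {n | n ∈ excCurvePoints (ρ ≫ π) ∧ ρ.base n ∈ sepNodes π} = sepNodes π := by
  ext z
  constructor
  · rintro ⟨n, hn, rfl⟩; exact hn.2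
  · intro hz
    obtain ⟨n, hn, hfib⟩ := hnode z hz
    have hρn : ρ.base n = z := by
      have : n ∈ ρ.base ⁻¹' {z} := by rw [hfib]; exact subset_closure (Set.mem_singleton n)
      exact this
    exact ⟨n, ⟨hn, hρn ▸ hz⟩, hρn⟩

include hnode in
/-- **hC for the node blow-up**: `ρ(F)` (= the node set) is closed — finitely many closed points (`isClosed_sepNodes`). [this work] -/
theorem isClosed_image_nodeCurves [IsNoetherianRing S] [IsProper π] (hfin : (excCurvePoints π).Finite) :
    IsClosed (ρ.base '' {n | n ∈ excCurvePoints (ρ ≫ π) ∧ ρ.base n ∈ sepNodes π}) := by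
  rw [image_nodeCurves_eq π ρ hnode]
  exact isClosed_sepNodes π hfin

/-- **hc for the node blow-up**: nodes are closed points. [this work] -/
theorem isClosed_singleton_image {n : X1} (hn : n ∈ excCurvePoints (ρ ≫ π) ∧ ρ.base n ∈ sepNodes π) :
    IsClosed ({ρ.base n} : Set X) :=
  isClosed_singleton_of_mem_sepNodes π hn.2

include hnode in
/-- **hiso for the node blow-up**: a blow-up `ρ` of the vanishing ideal of `closure (sepNodes π)` (the `IsSepX1Sandwiched` clause)
restricts to an ISOMORPHISM over the complement of `ρ(F) = sepNodes π = closure (sepNodes π)` = its centre (tree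
`IsBlowup.isIso_morphismRestrict`, Görtz–Wedhorn Prop. 13.91 (3)). [cite: GortzWedhorn2020, Prop. 13.91] -/
theorem isIso_morphismRestrict_compl_image [IsNoetherianRing S] [IsProper π] (hfin : (excCurvePoints π).Finite)
    (hρ : IsBlowup ρ (vanishingIdeal ⟨closure (sepNodes π), isClosed_closure⟩))
    (hC : IsClosed (ρ.base '' {n | n ∈ excCurvePoints (ρ ≫ π) ∧ ρ.base n ∈ sepNodes π})) :
    IsIso (ρ ∣_ (⟨(ρ.base '' {n | n ∈ excCurvePoints (ρ ≫ π) ∧ ρ.base n ∈ sepNodes π})ᶜ, hC.isOpen_compl⟩ : X.Opens)) := by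
  refine hρ.isIso_morphismRestrict ?_
  change Disjoint (ρ.base '' {n | n ∈ excCurvePoints (ρ ≫ π) ∧ ρ.base n ∈ sepNodes π})ᶜ
    ((vanishingIdeal (⟨closure (sepNodes π), isClosed_closure⟩ : Closeds X)).support : Set X)
  rw [coe_support_vanishingIdeal, image_nodeCurves_eq π ρ hnode]
  change Disjoint (sepNodes π)ᶜ (closure (sepNodes π))
  rw [closure_sepNodes_eq π hfin]
  exact disjoint_compl_left

include hnode in
/-- **`excCurvePoints π = ρ(OLD)`** for the node blow-up: the integral exceptional curves downstairs are exactly the images of the old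
curves `excCurvePoints (ρ ≫ π) ∖ F` upstairs, and `ρ` is injective on them (the lead's `Contraction.excCurvePoints_eq_image` /
`injOn_excCurvePoints_diff` with every clause discharged; `hht` = points of `X¹` over the closed point have height `≤ 1`). [folklore] -/
theorem excCurvePoints_eq_image_nodeBlowup [IsNoetherianRing S] [IsProper π] [IsProper ρ] (hfin : (excCurvePoints π).Finite)
    (hρ : IsBlowup ρ (vanishingIdeal ⟨closure (sepNodes π), isClosed_closure⟩))
    (hht : ∀ w : X1, (ρ ≫ π).base w = closedPoint S → Order.height w ≤ 1) :
    excCurvePoints π = ρ.base '' (excCurvePoints (ρ ≫ π) \ {n | n ∈ excCurvePoints (ρ ≫ π) ∧ ρ.base n ∈ sepNodes π}) ∧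
      Set.InjOn ρ.base (excCurvePoints (ρ ≫ π) \ {n | n ∈ excCurvePoints (ρ ≫ π) ∧ ρ.base n ∈ sepNodes π}) := by
  have hC := isClosed_image_nodeCurves π ρ hnode hfin
  have hiso := isIso_morphismRestrict_compl_image π ρ hnode hfin hρ hC
  exact ⟨Contraction.excCurvePoints_eq_image (ρ ≫ π) π ρ rfl (fun n hn => hn.1)
      (fun n hn => preimage_singleton_eq_closure π ρ hnode hn.1 hn.2) hC hiso hht
      (fun n hn => isClosed_singleton_image π ρ hn),
    Contraction.injOn_excCurvePoints_diff (ρ ≫ π) ρ (fun n hn => hn.1)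
      (fun n hn => preimage_singleton_eq_closure π ρ hnode hn.1 hn.2) hC hiso⟩

include hnode in
/-- **THE SUBDIVISION CLAUSE FOR THE NODE BLOW-UP.**  `π : X → Spec S` proper (`S` Noetherian local) with finitely many exceptional
curves; `ρ : X¹ → X` a (proper) blow-up of the vanishing ideal of `closure (sepNodes π)` (`IsSepX1Sandwiched`); the fibre over each
node is one integral exceptional curve (`hnode`, by signature); points of `X¹` over the closed point have height `≤ 1` (`hht`);
`incidenceGraph π` ACYCLIC (UP-6, stub-3's `incidenceGraph_isAcyclic`); every node lies under two DISTINCT exceptional curves (`hsplit`,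
the `𝒩₀` condition of the split core).  THEN every new curve `n` (exceptional curve of `ρ ≫ π` over a node) has EXACTLY TWO neighbours in
`incidenceGraph (ρ ≫ π)`, both OLD. [cite: Lipman1969, §24 (p. 258)] -/
theorem subdivision_nodeBlowup [IsNoetherianRing S] [IsProper π] [IsProper ρ] (hfin : (excCurvePoints π).Finite)
    (hρ : IsBlowup ρ (vanishingIdeal ⟨closure (sepNodes π), isClosed_closure⟩))
    (hht : ∀ w : X1, (ρ ≫ π).base w = closedPoint S → Order.height w ≤ 1)
    (hG : (incidenceGraph π).IsAcyclic)
    (hsplit : ∀ z ∈ sepNodes π, ∃ a b : X, a ∈ excCurvePoints π ∧ b ∈ excCurvePoints π ∧ a ≠ b ∧ a ⤳ z ∧ b ⤳ z) :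
    ∀ n ∈ {n | n ∈ excCurvePoints (ρ ≫ π) ∧ ρ.base n ∈ sepNodes π}, ∃ a b : X1,
      a ∈ excCurvePoints (ρ ≫ π) \ {n | n ∈ excCurvePoints (ρ ≫ π) ∧ ρ.base n ∈ sepNodes π} ∧
      b ∈ excCurvePoints (ρ ≫ π) \ {n | n ∈ excCurvePoints (ρ ≫ π) ∧ ρ.base n ∈ sepNodes π} ∧ a ≠ b ∧
      (incidenceGraph (ρ ≫ π)).Adj n a ∧ (incidenceGraph (ρ ≫ π)).Adj n b ∧
      ∀ c : X1, (incidenceGraph (ρ ≫ π)).Adj n c → c = a ∨ c = b := by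
  have hC := isClosed_image_nodeCurves π ρ hnode hfin
  have hiso := isIso_morphismRestrict_compl_image π ρ hnode hfin hρ hC
  exact Subdivision.subdivision_clause_of_isAcyclic (ρ ≫ π) π ρ rfl (fun n hn => hn.1)
    (fun n hn => preimage_singleton_eq_closure π ρ hnode hn.1 hn.2) hC hiso
    (fun n hn => isClosed_singleton_image π ρ hn) hht hG (fun n hn => hsplit _ hn.2)

include hnode in
/-- The subdivision clause for the node blow-up when `ψ = ρ ≫ π` is a RESOLUTION of the two-dimensional Noetherian local domain `S`
(`hht` discharged by `IsResolution.height_le_one_of_base_eq_closedPoint`; `ρ` is proper as `ψ` is proper and `π` separated —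
Mathlib `IsProper.of_comp`). [cite: Lipman1969, §24 (p. 258)] -/
theorem subdivision_nodeBlowup_of_isResolution [IsNoetherianRing S] [IsDomain S] [IsProper π] (h2 : ringKrullDim S = 2)
    (hψ : IsResolution (ρ ≫ π)) (hfin : (excCurvePoints π).Finite)
    (hρ : IsBlowup ρ (vanishingIdeal ⟨closure (sepNodes π), isClosed_closure⟩))
    (hG : (incidenceGraph π).IsAcyclic)
    (hsplit : ∀ z ∈ sepNodes π, ∃ a b : X, a ∈ excCurvePoints π ∧ b ∈ excCurvePoints π ∧ a ≠ b ∧ a ⤳ z ∧ b ⤳ z) :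
    ∀ n ∈ {n | n ∈ excCurvePoints (ρ ≫ π) ∧ ρ.base n ∈ sepNodes π}, ∃ a b : X1,
      a ∈ excCurvePoints (ρ ≫ π) \ {n | n ∈ excCurvePoints (ρ ≫ π) ∧ ρ.base n ∈ sepNodes π} ∧
      b ∈ excCurvePoints (ρ ≫ π) \ {n | n ∈ excCurvePoints (ρ ≫ π) ∧ ρ.base n ∈ sepNodes π} ∧ a ≠ b ∧
      (incidenceGraph (ρ ≫ π)).Adj n a ∧ (incidenceGraph (ρ ≫ π)).Adj n b ∧
      ∀ c : X1, (incidenceGraph (ρ ≫ π)).Adj n c → c = a ∨ c = b := by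
  haveI : IsProper (ρ ≫ π) := hψ.isProper
  haveI : IsProper ρ := IsProper.of_comp ρ π
  exact subdivision_nodeBlowup π ρ hnode hfin hρ
    (fun w hw => hψ.height_le_one_of_base_eq_closedPoint h2 hw) hG hsplit

end Summit.ResolutionOfSingularities.ResolutionOfSingularities.Theorems.NoZeno.ExcCount.NodeBlowup

end
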